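import Literature.Topology.FourManifolds.LefschetzBaseRegular
import Literature.Topology.FourManifolds.TorusCoordinates
import Literature.Topology.PlaneTopology.WindingNumber
import Literature.AlgebraicTopology.SingularHomology.HurewiczOne
import Mathlib.Analysis.SpecialFunctions.Pow.Continuity
import HarnessLib

/-!
# The standard Lefschetz base of genus `g`, III: pages, page framings and the homology shadow

Topic `Literature/Topology/FourManifolds`; namespace `Literature.Topology.FourManifolds.LefschetzBase`.
Third vocabulary file of the concrete base `Base g = {‖y² − x^{2g+1} − 1‖² + eta ‖x‖² ≤ 1/4} ⊂ ℂ²`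
(`LefschetzBaseModel.lean`, `LefschetzBaseRegular.lean`).  Definitions + proved lemmas; NOTHING is
asserted.  What a Lefschetz 2-handle needs from the base (Etnyre–Fuller 2006, §2: *"attaching
2-handles along the `γ_{p_i}`'s with framing one less than the framing induced by `Σ`"*;
Gompf–Stipsicz 1999, §8.2) is made of formulas here:

* §5 **pages.**  In the flat region `‖x‖ < 2` the boundary of the base is `{‖w‖ = 1/2}`
  (`w = y² − x^{2g+1} − 1`), fibred by the complex curves `w = c/2`, `‖c‖ = 1`: `page g c` is that
  curve (as a subset of `Base g`; it lies in the boundary, `page_subset_boundary`).  The angular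
  positions of the letters of a word of length `n` are `pageDir n i = exp(−2πi (i + 1/2)/n)`
  (clockwise in `i`).
* §6 **page framing.**  Along a loop `K` in a page, the normal bundle of `K` in `∂ Base g` is framed
  by `(i K', n)`: `i K'` is the normal of `K` inside the page (pages are complex curves, so their
  tangent lines are complex lines) and `n = horizNormal` is the vector with `dΦ(n) = i w`
  `ℂ`-orthogonal to the page (the direction of increasing page angle; for the Stein structure of
  `F × D² ⊂ ℂ²` it is `J` of the outward normal, i.e. the Reeb-type direction `R` of
  `SteinBoundaryContact.lean`).  The PAGE TWISTING `pageTwisting g K ν ∈ ℤ` of a framing `ν` of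
  `K` is the winding number (`Literature.Topology.PlaneTopology.wind`) of its coordinates in that
  frame — the same recipe as `SteinStructure.twisting` (twisting relative to `(J ċ, R)`), so that
  "framing one LESS than the page framing" is `pageTwisting = -1` (a positive Lefschetz handle,
  `tb − 1` in the Stein dictionary of Baykur 2006, p. 14) and "one MORE" is `pageTwisting = 1`.
  Vectors tangent to `Base g` are read in the ambient `ℝ⁴` through the differential of the
  inclusion (`ambient`).
* §7 **homology shadow.**  The central page `{y² = x^{2g+1} + 1}` is the Milnor fibre of `A_{2g}`;
  over the chords `[ζ_i, ζ_{i+1}]` between consecutive roots `ζ_k = exp(iπ(2k+1)/(2g+1))` of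
  `x^{2g+1} = −1` lie the `2g` loops `chainLoop g i` (upper sheet out, lower sheet back; the square
  root is continuous since `Re(x^{2g+1} + 1) > 0` inside the unit disc) — the classical
  distinguished basis of vanishing cycles, an `A_{2g}` chain of curves meeting consecutively once
  (Milnor 1968, §9; Arnold–Gusein-Zade–Varchenko II, §2).  In a symplectic basis `(e_j, f_j)` of
  `H₁(F_{g,1}; ℤ) = ℤ^{2g}` (pairing `stdSymp`, `SignedHurwitzAction.lean`) such a chain is
  `v_{2j} = e_j − e_{j−1}`, `v_{2j+1} = f_j` (`chainVec`; `stdSymp (v_i) (v_{i+1}) = 1`).  The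
  HOMOLOGY SHADOW `shadowMap g : H₁(Base g; ℤ) →ₗ[ℤ] ℤ^{2g}` is a linear bijection sending the
  Hurewicz class (`loopClass`, `HurewiczOne.lean`) of `chainLoop g i` to `chainVec g i`, CHOSEN by
  `Classical.epsilon` against exactly that specification (`IsChainShadow`); that the specification
  is satisfiable — `H₁(Base g; ℤ)` is free on the chain — is Milnor's theorem (1968, Thm. 9.1 with
  Lemma 9.4) for this fibre and is NOT proved here (it is the content of a named fact over this
  vocabulary; until it is discharged, `shadowMap` is a definite but unidentified linear map, exactly
  like the junk values of `OpenBook.proj` on the binding).  `shadow g K` is the shadow of a loop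
  `K : 𝕊¹ → Base g`.

## Conventions (derivations, for the auditor)

(a) ORIENTATIONS AND THE SIGN OF THE TWISTING.  `Base g` carries the complex orientation of `ℂ²`
and `∂ Base g` the boundary orientation (outward normal first).  At a point of a page, with
`L = ker dΦ` the (complex) tangent line of the page and `ν_out` the outward normal
(`dΦ(ν_out) ∈ ℝ₊ · w`), the basis `(K', iK', ν_out, n = i ν_out)` of `ℂ² = L ⊕ L^⊥` is complex-positive,
and `(ν_out, K', iK', n)` differs from it by an even permutation; hence `(K', iK', n)` is a positive
frame of `∂ Base g` and the winding number of `ν` in the oriented normal plane `(iK', n)` — our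
`pageTwisting` — is the number of right-handed full twists of `ν` relative to the page framing
(`iK'`, equivalently `n`), i.e. the framing coefficient of `ν` minus that of the page framing
(the same recipe, with the same handedness check, as `SteinStructure.twisting` relative to
`(J ċ, R)` in `SteinBoundaryContact.lean`).  Etnyre–Fuller 2006, §2: a positive critical point is a
2-handle "with framing one less than the framing induced by `Σ`" (total space oriented by the
orientation-preserving complex charts, here the complex orientation): `pageTwisting = -1`.
(b) ORDER.  Akbulut–Ozbagci 2001, §2.1–2.3, with every convention printed: functional notation
(`D(β)D(α)` applies `D(α)` first); an `F`-bundle over `S¹` "has monodromy `h` iff it is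
`(F × I)/(h(x), 0) ∼ (x, 1)`, in other words `h` is the monodromy if we travel around the base circle
in the positive normal direction to `F`"; arcs `s_1, …, s_m` "appear in order as we travel
counterclockwise in a small circle about `b_0`", each positive handle has framing `−1` relative to
the product framing and monodromy the positive twist `D(γ_i)`, and "continuing counterclockwise …
`∂M_0` is an `F`-bundle over `S¹` with monodromy given by the composition `D(γ_m) ⋯ D(γ_1)`".  In
the signed-word calculus `wordProduct [x_0, x_1, …] = T_{x_0} ∘ T_{x_1} ∘ ⋯` (first letter
outermost, applied LAST), so the word must list the vanishing cycles in the order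
`γ_m, γ_{m−1}, …, γ_1` — CLOCKWISE — for `wordProduct` to be the global monodromy; hence
`pageDir n i = e^{−2πi(i+½)/n}` decreases in angle as `i` increases (the positive normal direction of
our pages is increasing `arg w`: `d(arg w)(n) = Im(dΦ(n)/w) = 1 > 0` for the horizontal normal `n`,
`J` of the outward normal).  This is also the reading under which both disjuncts of `HurwitzStep`
(`(a, b) ↦ (t_a^{ε_a} b, a)`, `(a, b) ↦ (b, t_b^{−ε_b} a)`, from `t_a t_b = t_{t_a b} t_a`) are the
shadows of the two elementary arc changes.
(c) THE CHAIN IS A `+1`-CHAIN.  Near the common branch point `p = (ζ_{i+1}, 0)` of `chainLoop g i`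
and `chainLoop g (i+1)`, `y` is a holomorphic coordinate on the page; `chainLoop g i` crosses `p`
with velocity direction `−r_in`, `r_in = √(−f'(ζ_{i+1})(ζ_{i+1} − ζ_i))`, and `chainLoop g (i+1)`
with direction `+r_out`, `r_out = √(f'(ζ_{i+1})(ζ_{i+2} − ζ_{i+1}))` (principal roots;
`f'(ζ) = −(2g+1) ζ̄`, so `f'(ζ_{i+1})(ζ_{i+2} − ζ_{i+1}) = −(2g+1)(e^{iβ} − 1)`, `β = 2π/(2g+1)`, has
argument `β/2 − π/2 ∈ (−π/2, 0)` INDEPENDENTLY of `i`, and `r_in = e^{i(π−β)/2} r_out`); the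
intersection sign is `sign Im(conj(−r_in) r_out) = sign sin((π−β)/2) = +1` for every `i < 2g − 1`.
So the chain loops, with the orientations fixed here, form an `A_{2g}` chain with all consecutive
algebraic intersection numbers `+1` for the complex orientation of the page, matching
`stdSymp (chainVec g i) (chainVec g (i+1)) = 1`; the shadow `shadowMap` therefore carries the
intersection form of the page to `stdSymp`, and Picard–Lefschetz (`(t_γ)_* x = x + (γ · x) γ` for
the right-handed twist, Farb–Margalit Prop. 6.3 / Gompf–Stipsicz §8.2) reads as the `transvection`
of `SignedHurwitzAction.lean`.  A global sign error in (a)–(c) would exchange every named fact over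
this vocabulary with its mirror; the three checks above are the places to audit.

## References
* J. B. Etnyre, T. Fuller, *Realizing 4-manifolds as achiral Lefschetz fibrations*, IMRN 2006,
  §2. [EtnyreFuller2006]
* R. E. Gompf, A. I. Stipsicz, *4-Manifolds and Kirby Calculus*, GSM 20 (1999), §8.2.
* R. İ. Baykur, *Kähler decomposition of 4-manifolds*, AGT 6 (2006), p. 14. [Baykur2006]
* J. Milnor, *Singular points of complex hypersurfaces*, Ann. of Math. Studies 61 (1968), §9.
* V. I. Arnold, S. M. Gusein-Zade, A. N. Varchenko, *Singularities of Differentiable Maps II*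
  (1988), §2 (distinguished bases, `A_μ`).
* B. Farb, D. Margalit, *A Primer on Mapping Class Groups* (2012), Prop. 6.3 (Picard–Lefschetz on
  `H₁`).
* S. Akbulut, B. Ozbagci, *Lefschetz fibrations on compact Stein surfaces*, Geom. Topol. 5 (2001),
  §2.1–2.3 (conventions: functional notation, monodromy, counter-clockwise arcs, framing `−1`).
  [AkbulutOzbagci2001]
-/

noncomputable section

open scoped Manifold ContDiff Topology ComplexConjugate Real
open Set Function Metric Complex

namespace Literature.Topology.FourManifolds

/-- Local notation: `𝔼 n` is the model Euclidean space `EuclideanSpace ℝ (Fin n)`. -/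
local notation "𝔼 " n:arg => EuclideanSpace ℝ (Fin n)
/-- Local notation: the unit circle in `ℝ²`. -/
local notation "𝕊¹" => (Metric.sphere (0 : EuclideanSpace ℝ (Fin 2)) 1)

namespace LefschetzBase

/-! ## §5 Pages -/

/-- The angular position `exp(−2πi (i + 1/2)/n)` of the `i`-th of `n` letters: CLOCKWISE in `i`,
starting just before angle `0` — so that, travelling counter-clockwise (the positive normal direction
of the pages) from angle `0`, the letters are crossed in the order `n−1, …, 1, 0` and the global
monodromy is `wordProduct` of the word, first letter outermost (Akbulut–Ozbagci 2001, §2.3: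
functional notation, monodromy `D(γ_m) ⋯ D(γ_1)` for vanishing cycles `γ_1, …, γ_m` met
counter-clockwise). [cite: AkbulutOzbagci2001, §2.3] -/
def pageDir (n i : ℕ) : ℂ := Complex.exp (((-(2 * π * (i + 1 / 2) / n) : ℝ)) * Complex.I)

/-- Page directions are unit complex numbers. [folklore] -/
@[simp] theorem norm_pageDir (n i : ℕ) : ‖pageDir n i‖ = 1 := by
  rw [pageDir, Complex.norm_exp_ofReal_mul_I]

/-- **The page of direction `c`** (`‖c‖ = 1`): the points of the base in the flat region `‖x‖² < 4`
with `w = c / 2`, i.e. the part over `‖x‖ < 2` of the complex curve `y² = x^{2g+1} + 1 + c/2` — a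
fibre of `Phi g` lying in `∂ Base g`. [cite: EtnyreFuller2006, §2] -/
def page (g : ℕ) (c : ℂ) : Set (Base g) :=
  {q | ‖cx q.1‖ ^ 2 < 4 ∧ w g q.1 = c / 2}

/-- On a page of unit direction, `rho = 1/4`. [folklore] -/
theorem rho_eq_of_mem_page (g : ℕ) {c : ℂ} (hc : ‖c‖ = 1) {q : Base g} (hq : q ∈ page g c) :
    rho g q.1 = 1 / 4 := by
  obtain ⟨hx, hw⟩ := hq
  rw [rho, hw, eta_of_le hx.le, norm_div, hc]
  norm_num

/-- **Pages lie in the boundary of the base.** [folklore] -/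
theorem page_subset_boundary (g : ℕ) {c : ℂ} (hc : ‖c‖ = 1) :
    page g c ⊆ (𝓡∂ 4).boundary (Base g) := fun q hq =>
  (RegularSublevel.mem_boundary_iff (isRegularLevel_rho g) q).2 (rho_eq_of_mem_page g hc hq)

/-- Distinct unit directions have disjoint pages. [folklore] -/
theorem disjoint_page (g : ℕ) {c c' : ℂ} (h : c ≠ c') : Disjoint (page g c) (page g c') := by
  rw [Set.disjoint_left]
  rintro q ⟨-, hw⟩ ⟨-, hw'⟩
  exact h (by have := hw.symm.trans hw'; field_simp at this; linear_combination this)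

/-! ## §6 The page frame and the page twisting of a framing -/

/-- The complex structure `i` of `ℂ²` on `ℝ⁴`. [folklore] -/
def cplxJ (v : 𝔼 4) : 𝔼 4 := mk (Complex.I * cx v) (Complex.I * cy v)

/-- The coefficient `a = ∂Φ/∂x = −(2g+1) x^{2g}` of `dΦ = a dx + b dy`. [folklore] -/
def dPhiX (g : ℕ) (q : 𝔼 4) : ℂ := -((2 * g + 1 : ℕ) * cx q ^ (2 * g))

/-- The coefficient `b = ∂Φ/∂y = 2y` of `dΦ = a dx + b dy`. [folklore] -/
def dPhiY (q : 𝔼 4) : ℂ := 2 * cy q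

/-- **The horizontal normal** `n(q)`: the vector of `ℂ²`, `ℂ`-orthogonal to the page through `q`
(`n = λ (ā, b̄)`), with `dΦ_q(n) = i · w(q)` (`λ = i w / (|a|² + |b|²)`) — the direction in
`∂ Base g` of increasing page angle; `J` of the outward normal of the tube `{‖w‖ = 1/2}`.
[folklore] -/
def horizNormal (g : ℕ) (q : 𝔼 4) : 𝔼 4 :=
  let lam : ℂ := Complex.I * w g q / ((‖dPhiX g q‖ ^ 2 + ‖dPhiY q‖ ^ 2 : ℝ) : ℂ)
  mk (lam * conj (dPhiX g q)) (lam * conj (dPhiY q))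

/-- A tangent vector `v ∈ T_x Base g` (read in the preferred chart at `x`) as a vector of the
ambient `ℝ⁴`: its image under the differential of the inclusion `Base g ↪ ℝ⁴`. [folklore] -/
def ambient (g : ℕ) (x : Base g) (v : 𝔼 4) : 𝔼 4 :=
  mfderiv (𝓡∂ 4) (𝓡 4) (RegularSublevel.incl (isRegularLevel_rho g)) x v

/-- The unit-period ambient parametrisation `t ↦ K(e^{2πit}) ∈ ℝ⁴` of a loop `K : 𝕊¹ → Base g`.
[folklore] -/
def ambCurve (g : ℕ) (K : 𝕊¹ → Base g) (t : ℝ) : 𝔼 4 := (K (circlePt t)).1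

/-- **The twisting loop of a framing `ν` of the loop `K` with respect to the page frame**:
`t ↦ (⟪ν, i K'⟫, ⟪ν, n⟫)`, the coordinates (up to the positive factors `‖K'‖²`, `‖n‖²`) of the
normal vector `ν(t)` in the frame `(i K'(t), n(K(t)))` of the normal bundle of `K` in `∂ Base g`
(`K'` the ambient velocity, `ν` read in `ℝ⁴` through `ambient`). [folklore] -/
def pageTwistingLoop (g : ℕ) (K : 𝕊¹ → Base g) (ν : 𝕊¹ → 𝔼 4) (t : ℝ) : ℂ :=
  ⟨inner ℝ (ambient g (K (circlePt t)) (ν (circlePt t))) (cplxJ (deriv (ambCurve g K) t)),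
   inner ℝ (ambient g (K (circlePt t)) (ν (circlePt t))) (horizNormal g (ambCurve g K t))⟩

/-- **The page twisting of the framing `ν` of `K`**: the winding number of its twisting loop — the
number of right-handed full twists of `ν` relative to the page framing as `K` is traversed once
(`∂ Base g` oriented as the boundary of the complex domain).  A Lefschetz 2-handle attached along a
curve in a page has page twisting `-1` if positive (framing "one less than the framing induced by
the fibre") and `+1` if negative (achiral; "one more"). [cite: EtnyreFuller2006, §2] -/
def pageTwisting (g : ℕ) (K : 𝕊¹ → Base g) (ν : 𝕊¹ → 𝔼 4) : ℤ :=
  Literature.Topology.PlaneTopology.wind (pageTwistingLoop g K ν)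

/-! ## §7 The `A_{2g}` chain on the central page and the homology shadow -/

/-- The angle `π(2k+1)/(2g+1)` of the `k`-th root of `x^{2g+1} = −1`. [folklore] -/
def branchAngle (g k : ℕ) : ℝ := π * (2 * k + 1) / (2 * g + 1)

/-- The roots `ζ_k = exp(iπ(2k+1)/(2g+1))` of `x^{2g+1} = −1`: the branch points of the central
page over the `x`-plane. [cite: Milnor1968, §9] -/
def branchPt (g k : ℕ) : ℂ := Complex.exp ((branchAngle g k : ℝ) * Complex.I)

/-- `ζ_k^{2g+1} = −1`. [folklore] -/
theorem branchPt_pow (g k : ℕ) : branchPt g k ^ (2 * g + 1) = -1 := by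
  rw [branchPt, ← Complex.exp_nat_mul]
  have hr : ((2 * g + 1 : ℕ) : ℝ) * branchAngle g k = 2 * π * k + π := by
    unfold branchAngle
    have : (2 * (g : ℝ) + 1) ≠ 0 := by positivity
    push_cast
    field_simp
  have h : ((2 * g + 1 : ℕ) : ℂ) * ((branchAngle g k : ℝ) * Complex.I) =
      (k : ℂ) * (2 * π * Complex.I) + π * Complex.I := by
    calc ((2 * g + 1 : ℕ) : ℂ) * ((branchAngle g k : ℝ) * Complex.I)
        = ((((2 * g + 1 : ℕ) : ℝ) * branchAngle g k : ℝ) : ℂ) * Complex.I := by push_cast; ring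
      _ = ((2 * π * k + π : ℝ) : ℂ) * Complex.I := by rw [hr]
      _ = (k : ℂ) * (2 * π * Complex.I) + π * Complex.I := by push_cast; ring
  rw [h, Complex.exp_add, Complex.exp_nat_mul_two_pi_mul_I, one_mul, Complex.exp_pi_mul_I]

/-- `‖ζ_k‖ = 1`. [folklore] -/
theorem norm_branchPt (g k : ℕ) : ‖branchPt g k‖ = 1 := by
  rw [branchPt, Complex.norm_exp_ofReal_mul_I]

/-- The `x`-coordinate `(1 − s) ζ_i + s ζ_{i+1}` of the `i`-th chord. [folklore] -/
def chordX (g i : ℕ) (s : ℝ) : ℂ := (1 - s) * branchPt g i + s * branchPt g (i + 1)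

/-- The chord is a continuous function of its parameter. [folklore] -/
theorem continuous_chordX (g i : ℕ) : Continuous (chordX g i) := by
  unfold chordX; fun_prop

/-- The chord starts at `ζ_i` … [folklore] -/
@[simp] theorem chordX_zero (g i : ℕ) : chordX g i 0 = branchPt g i := by simp [chordX]

/-- … and ends at `ζ_{i+1}`. [folklore] -/
@[simp] theorem chordX_one (g i : ℕ) : chordX g i 1 = branchPt g (i + 1) := by simp [chordX]

/-- The chord stays in the closed unit disc. [folklore] -/
theorem norm_chordX_le (g i : ℕ) {s : ℝ} (hs : s ∈ Icc (0 : ℝ) 1) : ‖chordX g i s‖ ≤ 1 := by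
  obtain ⟨h0, h1⟩ := hs
  calc ‖chordX g i s‖ ≤ ‖((1 - s : ℝ) : ℂ) * branchPt g i‖ + ‖(s : ℂ) * branchPt g (i + 1)‖ := by
          rw [chordX]; push_cast; exact norm_add_le _ _
    _ = (1 - s) + s := by
          rw [norm_mul, norm_mul, norm_branchPt, norm_branchPt, Complex.norm_real, Complex.norm_real,
            Real.norm_eq_abs, Real.norm_eq_abs, abs_of_nonneg (by linarith), abs_of_nonneg h0]
          ring
    _ = 1 := by ring

/-- The principal square root `z ↦ z^{1/2}`. [folklore] -/
def csqrt (z : ℂ) : ℂ := z ^ ((2 : ℂ)⁻¹)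

/-- `(z^{1/2})² = z`. [folklore] -/
theorem csqrt_sq (z : ℂ) : csqrt z ^ 2 = z := Complex.cpow_nat_inv_pow z two_ne_zero

/-- `0^{1/2} = 0`. [folklore] -/
@[simp] theorem csqrt_zero : csqrt 0 = 0 := Complex.zero_cpow (inv_ne_zero two_ne_zero)

/-- The square root is continuous at every point of the closed right half-plane `Re z ≥ 0`
(on the open half-plane and off the real axis it is analytic, these points lying in the slit
plane; at `0` because `‖z^{1/2}‖ = ‖z‖^{1/2}`). [folklore] -/
theorem continuousAt_csqrt {z : ℂ} (hz : 0 ≤ z.re) : ContinuousAt csqrt z := by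
  by_cases h0 : z = 0
  · subst h0
    have h := Complex.continuousAt_cpow_zero_of_re_pos (z := (2 : ℂ)⁻¹) (by norm_num)
    have h2 : ContinuousAt (fun y : ℂ => (y, (2 : ℂ)⁻¹)) 0 := continuousAt_id.prodMk continuousAt_const
    have h3 : ContinuousAt ((fun x : ℂ × ℂ => x.1 ^ x.2) ∘ fun y : ℂ => (y, (2 : ℂ)⁻¹)) 0 :=
      ContinuousAt.comp (f := fun y : ℂ => (y, (2 : ℂ)⁻¹)) h h2
    exact h3
  · refine continuousAt_cpow_const (Or.elim (lt_or_eq_of_le hz) Or.inl fun h => Or.inr ?_)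
    intro him
    exact h0 (Complex.ext h.symm him)

/-- `x^{2g+1} + 1` has non-negative real part on the closed unit disc. [folklore] -/
theorem re_pow_add_one_nonneg (g : ℕ) {x : ℂ} (hx : ‖x‖ ≤ 1) : 0 ≤ (x ^ (2 * g + 1) + 1).re := by
  rw [Complex.add_re, Complex.one_re]
  have h1 : |(x ^ (2 * g + 1)).re| ≤ ‖x ^ (2 * g + 1)‖ := Complex.abs_re_le_norm _
  rw [norm_pow] at h1
  have h2 : ‖x‖ ^ (2 * g + 1) ≤ 1 := pow_le_one₀ (norm_nonneg _) hx
  have h3 := neg_abs_le (x ^ (2 * g + 1)).re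
  linarith

/-- `(a, b) ↦ mk a b` is continuous. [folklore] -/
theorem continuous_mk : Continuous fun z : ℂ × ℂ => mk z.1 z.2 := by
  have e : (fun z : ℂ × ℂ => mk z.1 z.2) =
      fun z => (EuclideanSpace.equiv (Fin 4) ℝ).symm ![z.1.re, z.1.im, z.2.re, z.2.im] := by
    funext z; rfl
  rw [e]
  refine (EuclideanSpace.equiv (Fin 4) ℝ).symm.continuous.comp ?_
  refine continuous_pi fun j => ?_
  fin_cases j
  · exact Complex.continuous_re.comp continuous_fst
  · exact Complex.continuous_im.comp continuous_fst
  · exact Complex.continuous_re.comp continuous_snd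
  · exact Complex.continuous_im.comp continuous_snd

/-- The upper (`ε = 1`) and lower (`ε = −1`) lifts of the `i`-th chord to the central page:
`s ↦ (x(s), ε √(x(s)^{2g+1} + 1))`. [cite: Milnor1968, §9] -/
def chordLift (g i : ℕ) (ε : ℂ) (s : ℝ) : 𝔼 4 :=
  mk (chordX g i s) (ε * csqrt (chordX g i s ^ (2 * g + 1) + 1))

/-- The lifts are continuous on `[0, 1]`. [folklore] -/
theorem continuousOn_chordLift (g i : ℕ) (ε : ℂ) : ContinuousOn (chordLift g i ε) (Icc 0 1) := by
  have hpoly : Continuous fun s : ℝ => chordX g i s ^ (2 * g + 1) + 1 :=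
    ((continuous_chordX g i).pow _).add continuous_const
  have hsq : ContinuousOn csqrt {z : ℂ | 0 ≤ z.re} := fun z hz =>
    (continuousAt_csqrt hz).continuousWithinAt
  have h3 : ContinuousOn (fun s => csqrt (chordX g i s ^ (2 * g + 1) + 1)) (Icc 0 1) :=
    hsq.comp hpoly.continuousOn fun s hs => re_pow_add_one_nonneg g (norm_chordX_le g i hs)
  have h4 : ContinuousOn (fun s => ε * csqrt (chordX g i s ^ (2 * g + 1) + 1)) (Icc 0 1) :=
    continuousOn_const.mul h3
  exact continuous_mk.comp_continuousOn ((continuous_chordX g i).continuousOn.prodMk h4)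

/-- The lifts lie on the central page with `‖x‖ ≤ 1`, hence in `{rho = 0} ⊆ Base g`. [folklore] -/
theorem rho_chordLift (g i : ℕ) {ε : ℂ} (hε : ε ^ 2 = 1) {s : ℝ} (hs : s ∈ Icc (0 : ℝ) 1) :
    rho g (chordLift g i ε s) = 0 := by
  have hw : w g (chordLift g i ε s) = 0 := by
    simp only [w, Phi, chordLift, cx_mk, cy_mk]
    rw [mul_pow, hε, csqrt_sq]; ring
  refine rho_eq_zero_of_w_eq_zero g hw ?_
  simp only [chordLift, cx_mk]
  nlinarith [norm_chordX_le g i hs, norm_nonneg (chordX g i s)]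

/-- The lift starts at `(ζ_i, 0)` … [folklore] -/
theorem chordLift_zero (g i : ℕ) (ε : ℂ) : chordLift g i ε 0 = mk (branchPt g i) 0 := by
  simp [chordLift, branchPt_pow]

/-- … and ends at `(ζ_{i+1}, 0)`. [folklore] -/
theorem chordLift_one (g i : ℕ) (ε : ℂ) : chordLift g i ε 1 = mk (branchPt g (i + 1)) 0 := by
  simp [chordLift, branchPt_pow]

/-- The branch point `(ζ_k, 0)` of the central page lies in `{rho = 0}`. [folklore] -/
theorem rho_mk_branchPt (g k : ℕ) : rho g (mk (branchPt g k) 0) = 0 := by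
  refine rho_eq_zero_of_w_eq_zero g ?_ ?_
  · simp [w, Phi, branchPt_pow]
  · simp [norm_branchPt]

/-- The branch point `(ζ_k, 0)` as a point of the base. [folklore] -/
def chordEnd (g k : ℕ) : Base g :=
  ⟨mk (branchPt g k) 0, by
    show rho g (mk (branchPt g k) 0) ≤ 1 / 4
    rw [rho_mk_branchPt]; norm_num⟩

/-- The lift of the `i`-th chord as a path in the base, from `(ζ_i, 0)` to `(ζ_{i+1}, 0)` on the
sheet `ε` (`ε = ±1`). [cite: Milnor1968, §9] -/
def chordPath (g i : ℕ) (ε : ℂ) (hε : ε ^ 2 = 1) : Path (chordEnd g i) (chordEnd g (i + 1)) where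
  toFun s := ⟨chordLift g i ε s, by
    show rho g (chordLift g i ε s) ≤ 1 / 4
    rw [rho_chordLift g i hε s.2]; norm_num⟩
  continuous_toFun := by
    refine Continuous.subtype_mk ?_ _
    exact (continuousOn_chordLift g i ε).comp_continuous continuous_subtype_val fun s => s.2
  source' := by
    apply Subtype.ext
    show chordLift g i ε 0 = mk (branchPt g i) 0
    exact chordLift_zero g i ε
  target' := by
    apply Subtype.ext
    show chordLift g i ε 1 = mk (branchPt g (i + 1)) 0
    exact chordLift_one g i ε

/-- **The `i`-th loop of the `A_{2g}` chain** (`i < 2g`): out along the `i`-th chord on the upper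
sheet, back on the lower sheet — a simple closed curve on the central page through the branch
points `ζ_i`, `ζ_{i+1}`. [cite: Milnor1968, §9] -/
def chainLoop (g i : ℕ) : Path (chordEnd g i) (chordEnd g i) :=
  (chordPath g i 1 (one_pow 2)).trans (chordPath g i (-1) (by norm_num)).symm

/-- **The chain vectors** in `ℤ^{2g} = ℤ^g ⊕ ℤ^g` (symplectic coordinates `(e_j, f_j)` for
`stdSymp`): `v_{2j} = e_j − e_{j−1}` (`e_{−1} = 0`), `v_{2j+1} = f_j`; consecutive ones pair to `1`
under `stdSymp`, all others to `0`, and they form a basis (the change of basis is unitriangular).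
[folklore] -/
def chainVec (g : ℕ) (i : ℕ) : Fin g ⊕ Fin g → ℤ :=
  if h : i / 2 < g then
    if i % 2 = 0 then
      Pi.single (Sum.inl ⟨i / 2, h⟩) 1 -
        (if 0 < i / 2 then Pi.single (Sum.inl ⟨i / 2 - 1, by omega⟩) 1 else 0)
    else Pi.single (Sum.inr ⟨i / 2, h⟩) 1
  else 0

open Literature.AlgebraicTopology.SingularHomology in
/-- **Specification of the homology shadow**: a `ℤ`-linear bijection
`H₁(Base g; ℤ) → ℤ^{2g}` sending the Hurewicz class of the `i`-th chain loop to the `i`-th chain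
vector (`i < 2g`).  Satisfiable by Milnor 1968, Thm. 9.1 / Lemma 9.4 (the fibre is a bouquet of
`2g` circles up to homotopy, with the chain as a basis of `H₁`) — not proved here. [cite: Milnor1968, Thm. 9.1] -/
def IsChainShadow (g : ℕ) (σ : singularHomology ℤ ℤ (Base g) 1 →ₗ[ℤ] (Fin g ⊕ Fin g → ℤ)) : Prop :=
  Function.Bijective σ ∧ ∀ i, i < 2 * g → σ (loopClass ℤ ℤ (1 : ℤ) (chainLoop g i)) = chainVec g i

open Literature.AlgebraicTopology.SingularHomology in
/-- **The homology shadow** `H₁(Base g; ℤ) → ℤ^{2g}`: a linear map satisfying `IsChainShadow`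
whenever one exists (`Classical.epsilon`). [cite: Milnor1968, Thm. 9.1] -/
def shadowMap (g : ℕ) : singularHomology ℤ ℤ (Base g) 1 →ₗ[ℤ] (Fin g ⊕ Fin g → ℤ) :=
  Classical.epsilon (IsChainShadow g)

/-- If the specification is satisfiable, `shadowMap g` satisfies it. [folklore] -/
theorem isChainShadow_shadowMap (g : ℕ) (h : ∃ σ, IsChainShadow g σ) : IsChainShadow g (shadowMap g) :=
  Classical.epsilon_spec h

/-- The unit-period loop `t ↦ K(e^{2πit})`, `t ∈ [0, 1]`, of a continuous `K : 𝕊¹ → X`, as a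
`Path`. [folklore] -/
def loopPath {X : Type*} [TopologicalSpace X] (K : 𝕊¹ → X) (hK : Continuous K) :
    Path (K (circlePt 0)) (K (circlePt 0)) where
  toFun s := K (circlePt s)
  continuous_toFun := hK.comp (continuous_circlePt.comp continuous_subtype_val)
  source' := rfl
  target' := by
    show K (circlePt (1 : ℝ)) = K (circlePt 0)
    rw [← circlePt_add_one 0, zero_add]

open Literature.AlgebraicTopology.SingularHomology in
/-- **The homology shadow of a loop `K : 𝕊¹ → Base g`**: the image of its Hurewicz class under
`shadowMap g` — for a curve on a page, its class in `H₁(F_{g,1}; ℤ) = ℤ^{2g}` in the symplectic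
coordinates fixed by the chain. [cite: Milnor1968, Thm. 9.1] -/
def shadow (g : ℕ) (K : 𝕊¹ → Base g) (hK : Continuous K) : Fin g ⊕ Fin g → ℤ :=
  shadowMap g (loopClass ℤ ℤ (1 : ℤ) (loopPath K hK))

end LefschetzBase

end Literature.Topology.FourManifolds
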